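import Summits.QuantumFields.YangMills.Theorems.BalabanUVNodesN15PerCubeGreenKnit
import Summits.QuantumFields.YangMills.Theorems.BalabanUVNodesN15PerCubeGreenSummand
import Summits.QuantumFields.YangMills.Theorems.BalabanUVNodesN15PerCubeGreenReg335
import HarnessLib

/-!
# N15 = NE2, road (c) — PROGRAMME (PC) «[B9] Sect. C FOR THE LANDAU LETTER WITH PER-CUBE GAUGES (3.35) AS PRINTED», FILE F: ★★★★ THE SCALAR COVARIANT GREEN's FUNCTION
# `(Δ_{R_U} + a·Q′*_UQ′_U)⁻¹` EXISTS, DECAYS EXPONENTIALLY AND IS A TWO-SIDED INVERSE FOR EVERY `U(m)` BOND FIELD IN BAŁABAN's PRINTED CLASS (3.35) PER CUBE — NO global gauge,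
# NO displayed row: FILE C's knit with the summand `P := a·Q′_Tᵀ Q′_T` LIVE (FILE E: conjugation law definitional, far row zero, cut row box-local) and the per-cube gauges with
# their (3.35) letters PRODUCED from ONE `Reg335Cube` datum per box (dag-n15-w2) (dag-n15-c g26, n15-c∕265)

Cell `pub-ymgap`, seat `pub-ymgap-dag-n15-c` (generation g26; R134 (a), s1 «first missing estimate»; HUMAN RULING D-0062; chair R424 venue).  `bears_on: R4∕N15 · K3⁸
SpineGivenEndpointR13SepCoPHV (stmt-QuantumFields-27366)`; filed `--kind proof --supports stmt-QuantumFields-27366 --as helper` — COUNT-NEUTRAL.  One theorem; 0 `def`, 0 `sorry`.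
Imports BY NAME n15-c∕262 `…PerCubeGreenKnit` (`uN_scGlued_spec`), n15-c∕264 `…PerCubeGreenSummand` (`scP`, `scNV`, `scP_conj`, `hasMaj_scNV_cut_of_rows`,
`one_sub_scPsi_comp_scNV_comp_scChi`), n15-c∕263 `…PerCubeGreenReg335` (`scChi_ne_zero_nbhd`; through it n15-c∕127, dag-n15-w2 g6
`CurvedSpecies.uN_exists_gauge_cutCoefLetters_of_reg335Cube` and lit-balaban r06 `B9Eq335RegularityClasses.Reg335Cube` = [B9] (3.35) on a cube).  Nothing in the tree is modified.

THE THEOREM `uN_scGreen_of_reg335Box`.  For odd `L ≥ 7`, `a₀ > 0`, a colour index `ι`: there are `δ, w₀, R₀, B > 0` such that on every doubled torus `2L·L^m` of the cover (`k ≥ 1`,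
`L^m ≥ w₀`), at King's mass `a = a_K(a₀,L,k)·(L^k)^{d+1}`, for trace-form coordinates `e` of `𝔲(m)` and EVERY `U(m)`-valued site bond field `U` that is in the class
`Reg335Cube (· + e_μ) U L^{−k} Q_k ξ C` on the box `Q_k = {x | B(x) ∈ c(2w+1,k) + [0,6w+3)}` around EVERY cut box, with the two explicit (3.35) letter bounds `≤ r_V` and
`r_V(1 + |J ⊕ J|) + a₀·|ι|(|ι|σ² + 2σ) ≤ R₀` (`σ = (1 + r_V L^{−k})^{(d+1)L^k} − 1`): THERE ARE per-cube unitary site gauges `w_k` such that the glued operator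
`𝒢 := scGlued … w U (a·Q′_Tᵀ Q′_T) (N_V)` satisfies `𝒢 ≤ B·e^{−(δ∕16)|y−y′|_T}` blockwise, `𝒢∘(Δ_{R_U} + a·Q′_Tᵀ Q′_T) = 1` and `(Δ_{R_U} + a·Q′_Tᵀ Q′_T)∘𝒢 = 1` on the coloured scalar
fields — i.e. Bałaban's `Δ′_a(U) = Δ^U + aQ′*(U)Q′(U)` ((3.24), in dag-n15-w3's spelling `covLapM + P` of (3.50)) has an exponentially decaying two-sided inverse `G′(U)` for `U` in
the PRINTED per-cube class: the SHAPE of [B9] Thm 3.7 p.409 («For M sufficiently large, and a configuration U satisfying (3.35), the operator G′ can be represented as G′ =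
G′₀(I − R′)⁻¹ … convergent») ∕ Cor. 3.6 p.408 ∕ Thm 3.1 (3.42) entry 0, at MODEL level.

HONEST FRAMING ∕ LIMITS.  Composition of LANDED theorems on MODEL carriers: FILE 70's doubled-cube torus cover (one scale `L^{−k}`, unit weights, block averaging `Q′` with plain
transposes at King's mass `a_K·n^{d+1}`), local propagators = the TORUS Green's function `G′(1)` compressed to the cubes (not the print's `G′_□` for the sequences `{Ω_n(□)}` of
p.408), `U(m)`-valued site bond fields in trace-form coordinates, crude constants; the identification of `covLapM + a·Q′_Tᵀ Q′_T` with n15-c∕197's matrix `claplA (cvT e U) a`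
(hence of `𝒢` with `mulVecLin (cGreen (cvT e U) a)`) is a dictionary step left to the sequel.  NOT [B9] Thm 3.1 ∕ 3.7 as printed; nothing of [B5]∕[B6]∕[B9] asserted.  NE2⁺ NOT
PRINTED, NOT proved; N15 of record untouched (DISCHARGED AS CONSUMED, p687738); K3⁸ OPEN; counts of record UNMOVED (typed 28∕28 · discharged 8∕27); one finite 𝕋⁴ at fixed ε
per index — NOT infinite volume, NOT OS on ℝ⁴, NOT a mass gap, NOT Clay; R4 closes the conditional finite-𝕋⁴ rung `BalabanLadder.UV` only.  Restate-immune (no Theses import).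
-/

noncomputable section

open scoped BigOperators Matrix Matrix.Norms.L2Operator

namespace Summit.QuantumFields.YangMills.BalabanUVNodes.N15.Gluing

open Real
open Literature.MathematicalPhysics.QuantumFieldTheory.Balaban1983to89
open Literature.MathematicalPhysics.QuantumFieldTheory.Balaban1983to89.B5Prop11Plancherel (Tor fine unitVec)
open Literature.MathematicalPhysics.QuantumFieldTheory.Balaban1983to89.B11SectG (BlockNorm HasMaj hasMaj_zero)
open Literature.MathematicalPhysics.QuantumFieldTheory.Balaban1983to89.B6Prop26Gluing (mulOp)
open Literature.MathematicalPhysics.QuantumFieldTheory.Balaban1983to89.B6UnitTorusCarrier (unitTorusGeo)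
open Literature.MathematicalPhysics.QuantumFieldTheory.Balaban1983to89.B9Eq335RegularityClasses (Reg335Cube)
open Literature.MathematicalPhysics.QuantumFieldTheory.King1986 (aK aK_pos aK_le)
open Literature.MathematicalPhysics.QuantumFieldTheory.King1986.Torus (blockOf)
open Literature.Barriers.QuantumFields (traceForm)
open Summit.QuantumFields.YangMills.BalabanUVNodes.N15.BackgroundLayer (covLapM tCoefA tCoefC)
open Summit.QuantumFields.YangMills.BalabanUVNodes.N15.VectorPiece (bshiftEquiv bshiftEquiv_apply)
open Summit.QuantumFields.YangMills.BalabanUVNodes.N15.MatrixSpecies (mmulOp coordMat basisConst liftEquiv)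
open Summit.QuantumFields.YangMills.BalabanUVNodes.N15.TwoGrid (chiCube cubeBlocks)
open Summit.QuantumFields.YangMills.BalabanUVNodes.N15.CurvedSpecies (gaugePair uN_exists_gauge_cutCoefLetters_of_reg335Cube)

variable {d : ℕ}

section Green

variable {L : ℕ} [NeZero L]

set_option maxHeartbeats 400000 in
/-- ★★★★ **THE SCALAR COVARIANT GREEN's FUNCTION FOR A BACKGROUND IN BAŁABAN's PRINTED CLASS (3.35) PER CUBE — existence, exponential decay, two-sided inverse, NO displayed row.**
For odd `L ≥ 7`, `a₀ > 0`, a colour index `ι`: there are `δ, w₀, R₀, B > 0` such that on every doubled torus `2L·L^m` of the cover (`k ≥ 1`, `L^m ≥ w₀`), at King's mass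
`a_K(a₀,L,k)·(L^k)^{d+1}`, for trace-form coordinates `e` of `𝔲(m)`, every `U(m)`-valued SITE bond field `U` in the class `Reg335Cube (· + e_μ) U L^{−k} Q_k ξ C` on the box around
every cut box, and every `r_V` dominating the two displayed explicit (3.35) letter bounds with `r_V(1 + |J ⊕ J|) + a₀|ι|(|ι|σ² + 2σ) ≤ R₀` (`σ = (1 + r_VL^{−k})^{(d+1)L^k} − 1`):
there are per-cube unitary site gauges `w_k` for which the glued operator of the compressed torus Green's functions for `Δ_{R_U} + a·Q′_Tᵀ Q′_T` is `≤ B·e^{−(δ∕16)|y−y′|_T}`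
blockwise AND is the two-sided inverse of `Δ_{R_U} + a·Q′_Tᵀ Q′_T` — Bałaban's `Δ′_a(U)`.  MODEL carriers; the SHAPE of [B9] Thm 3.7 ∕ Cor. 3.6 ∕ Thm 3.1 (3.42)₀ for `G′(U)`, NOT the printed theorems.
[cite: Balaban1985BackgroundPropagators, Thm 3.7 (3.90) p.409, Cor. 3.6 p.408, Thm 3.1 (3.42) p.397, (3.24)–(3.25) p.394, (3.34)–(3.35) p.396, (3.62)–(3.65) pp.402–403, (3.87)–(3.89) p.409 (shape ∕ mechanism); Balaban1984PropagatorsII, (2.91)–(2.93) p.239] -/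
theorem uN_scGreen_of_reg335Box (hL : Odd L ∧ 1 < L) (hL7 : 7 ≤ L) {a₀ : ℝ} (ha₀ : 0 < a₀) (ι : Type) [Fintype ι] [DecidableEq ι] :
    ∃ δ w₀ R₀ B : ℝ, 0 < δ ∧ 0 < R₀ ∧ 0 < B ∧
      ∀ (mv kk : ℕ), 1 ≤ kk → w₀ ≤ ((L ^ mv : ℕ) : ℝ) →
      ∀ {mm : Type} [Fintype mm] [DecidableEq mm] [Nonempty mm] (e : Matrix mm mm ℂ ≃L[ℝ] (ι → ℝ)), (∀ A B : Matrix mm mm ℂ, traceForm A B = e A ⬝ᵥ e B) →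
      ∀ (U : Fin (d + 1) → ScX d L mv kk hL → (Matrix mm mm ℂ)ˣ), (∀ μ x, (U μ x : Matrix mm mm ℂ) ∈ Matrix.unitaryGroup mm ℂ) →
      ∀ (ξ C : ℝ), 0 < ξ → 0 ≤ C →
        (∀ k, Reg335Cube (scShift d L mv kk hL) U ((((L ^ kk : ℕ) : ℝ))⁻¹) {x : ScX d L mv kk hL | blockOf (L ^ kk) (cvM d L mv kk hL) x ∈ cubeBlocks (cvM d L mv kk hL) (coverCorner (cvM d L mv kk hL) (L ^ mv) L (2 * L ^ mv + 1) k) (6 * L ^ mv + 3)} ξ C) →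
      ∀ (rV : ℝ), 0 ≤ rV →
        Fintype.card ι * (@basisConst ι _ (Matrix mm mm ℂ) Matrix.frobeniusNormedAddCommGroup Matrix.frobeniusNormedSpace e * (2 * Real.sqrt (Fintype.card mm)) * (Real.sqrt (Fintype.card mm) * ((C / ξ) * Real.exp (((((L ^ kk : ℕ) : ℝ))⁻¹) * (C / ξ))))) ≤ rV →
        Fintype.card ι * (Fintype.card (Fin (d + 1)) * (Fintype.card ι * (@basisConst ι _ (Matrix mm mm ℂ) Matrix.frobeniusNormedAddCommGroup Matrix.frobeniusNormedSpace e * (2 * Real.sqrt (Fintype.card mm)) * (Real.sqrt (Fintype.card mm) * ((C / ξ) * Real.exp (((((L ^ kk : ℕ) : ℝ))⁻¹) * (C / ξ))))) ^ 2 + @basisConst ι _ (Matrix mm mm ℂ) Matrix.frobeniusNormedAddCommGroup Matrix.frobeniusNormedSpace e * (2 * Real.sqrt (Fintype.card mm)) * (Real.sqrt (Fintype.card mm) * ((C / ξ ^ 2) * Real.exp (((((L ^ kk : ℕ) : ℝ))⁻¹) * (C / ξ)))))) ≤ rV →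
        rV * (1 + Fintype.card (Fin (d + 1) ⊕ Fin (d + 1))) + a₀ * (Fintype.card ι * (Fintype.card ι * ((1 + rV * ((((L ^ kk : ℕ) : ℝ))⁻¹)) ^ ((d + 1) * L ^ kk) - 1) ^ 2 + 2 * ((1 + rV * ((((L ^ kk : ℕ) : ℝ))⁻¹)) ^ ((d + 1) * L ^ kk) - 1))) ≤ R₀ →
      ∃ w : (Fin (d + 1) → ZMod (2 * L)) → ScX d L mv kk hL → Matrix mm mm ℂ, (∀ k x, (w k x)ᴴ * w k x = 1) ∧
        HasMaj (ScNorm d L mv kk hL ι) (ScNorm d L mv kk hL ι)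
            (scGlued d L mv kk hL (aK a₀ (L : ℝ) kk * (((L ^ kk : ℕ) : ℝ)) ^ (d + 1)) ((((L ^ kk : ℕ) : ℝ))⁻¹) ι e w (fun μ x => (U μ x : Matrix mm mm ℂ)) (scP d L mv kk hL (aK a₀ (L : ℝ) kk * (((L ^ kk : ℕ) : ℝ)) ^ (d + 1)) ι e (fun μ x => (U μ x : Matrix mm mm ℂ))) (scNV d L mv kk hL (aK a₀ (L : ℝ) kk * (((L ^ kk : ℕ) : ℝ)) ^ (d + 1)) ι e w (fun μ x => (U μ x : Matrix mm mm ℂ))))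
          (fun y y' => B * Real.exp (-(δ / 16 * (unitTorusGeo L kk (cvM d L mv kk hL)).dist y y'))) ∧
        (scGlued d L mv kk hL (aK a₀ (L : ℝ) kk * (((L ^ kk : ℕ) : ℝ)) ^ (d + 1)) ((((L ^ kk : ℕ) : ℝ))⁻¹) ι e w (fun μ x => (U μ x : Matrix mm mm ℂ)) (scP d L mv kk hL (aK a₀ (L : ℝ) kk * (((L ^ kk : ℕ) : ℝ)) ^ (d + 1)) ι e (fun μ x => (U μ x : Matrix mm mm ℂ))) (scNV d L mv kk hL (aK a₀ (L : ℝ) kk * (((L ^ kk : ℕ) : ℝ)) ^ (d + 1)) ι e w (fun μ x => (U μ x : Matrix mm mm ℂ))) ∘ₗ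
            (covLapM (scShift d L mv kk hL) ((((L ^ kk : ℕ) : ℝ))⁻¹) (gaugePair (scShift d L mv kk hL) (fun μ x => coordMat e (ContinuousLinearMap.mulLeftRight ℝ (Matrix mm mm ℂ) (U μ x : Matrix mm mm ℂ) (U μ x : Matrix mm mm ℂ)ᴴ))) +
              scP d L mv kk hL (aK a₀ (L : ℝ) kk * (((L ^ kk : ℕ) : ℝ)) ^ (d + 1)) ι e (fun μ x => (U μ x : Matrix mm mm ℂ))) = LinearMap.id ∧
          (covLapM (scShift d L mv kk hL) ((((L ^ kk : ℕ) : ℝ))⁻¹) (gaugePair (scShift d L mv kk hL) (fun μ x => coordMat e (ContinuousLinearMap.mulLeftRight ℝ (Matrix mm mm ℂ) (U μ x : Matrix mm mm ℂ) (U μ x : Matrix mm mm ℂ)ᴴ))) +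
              scP d L mv kk hL (aK a₀ (L : ℝ) kk * (((L ^ kk : ℕ) : ℝ)) ^ (d + 1)) ι e (fun μ x => (U μ x : Matrix mm mm ℂ))) ∘ₗ
            scGlued d L mv kk hL (aK a₀ (L : ℝ) kk * (((L ^ kk : ℕ) : ℝ)) ^ (d + 1)) ((((L ^ kk : ℕ) : ℝ))⁻¹) ι e w (fun μ x => (U μ x : Matrix mm mm ℂ)) (scP d L mv kk hL (aK a₀ (L : ℝ) kk * (((L ^ kk : ℕ) : ℝ)) ^ (d + 1)) ι e (fun μ x => (U μ x : Matrix mm mm ℂ))) (scNV d L mv kk hL (aK a₀ (L : ℝ) kk * (((L ^ kk : ℕ) : ℝ)) ^ (d + 1)) ι e w (fun μ x => (U μ x : Matrix mm mm ℂ))) = LinearMap.id) := by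
  obtain ⟨δ, w₀, R₀, θ₀, B, hδ, hR₀, hθ₀, hB, H⟩ := uN_scGlued_spec (d := d) hL hL7 ha₀ ι
  have hL1r : (1 : ℝ) < (L : ℝ) := by exact_mod_cast hL.2
  have hL3 : 3 ≤ L := by omega
  refine ⟨δ, max w₀ 2, R₀, B, hδ, hR₀, hB, fun mv kk hk hw₀ => ?_⟩
  intro mm _ _ _ e he U hU ξ C hξ hC h335 rV hrV hrA hrC hRle
  have hw₀' : w₀ ≤ ((L ^ mv : ℕ) : ℝ) := (le_max_left _ _).trans hw₀
  have hW2 : 2 ≤ L ^ mv := by have h := (le_max_right w₀ 2).trans hw₀; exact_mod_cast h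
  have hw : 0 < L ^ mv := by omega
  have hη : (0 : ℝ) < ((((L ^ kk : ℕ) : ℝ))⁻¹) := inv_pos.mpr (Nat.cast_pos.mpr (pow_pos (Nat.pos_of_ne_zero (NeZero.ne L)) kk))
  have hnr : (0 : ℝ) < ((L ^ kk : ℕ) : ℝ) := by exact_mod_cast pow_pos (Nat.pos_of_ne_zero (NeZero.ne L)) kk
  have hM : ∀ ν, cvM d L mv kk hL ν = 2 * L * L ^ mv := MP_succ_eq L mv kk hL
  have hm₁ : 2 * L ^ mv ≤ coverMargin L mv := two_mul_le_coverMargin hL7 mv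
  have hfitI : coverMargin L mv - 2 * L ^ mv + (6 * L ^ mv + 1) ≤ L * L ^ mv := coverMargin_inner_fit hL7 hW2
  have hS0 : L * L ^ mv ≤ 2 * L * L ^ mv := by rw [mul_assoc]; omega
  -- King's window at the index
  have haK : 0 < aK a₀ (L : ℝ) kk := aK_pos ha₀ hL1r hk
  have haKle : aK a₀ (L : ℝ) kk ≤ a₀ := aK_le ha₀ hL1r hk
  have ha' : 0 < (aK a₀ (L : ℝ) kk * (((L ^ kk : ℕ) : ℝ)) ^ (d + 1)) := by positivity
  -- the letter of the cut row
  have hσ0 : 0 ≤ ((1 + rV * ((((L ^ kk : ℕ) : ℝ))⁻¹)) ^ ((d + 1) * L ^ kk) - 1) := by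
    have := one_le_pow₀ (M₀ := ℝ) (a := 1 + rV * ((((L ^ kk : ℕ) : ℝ))⁻¹)) (by nlinarith [hη.le]) (n := (d + 1) * L ^ kk); linarith
  have hLσ0 : 0 ≤ Fintype.card ι * (Fintype.card ι * ((1 + rV * ((((L ^ kk : ℕ) : ℝ))⁻¹)) ^ ((d + 1) * L ^ kk) - 1) ^ 2 + 2 * ((1 + rV * ((((L ^ kk : ℕ) : ℝ))⁻¹)) ^ ((d + 1) * L ^ kk) - 1)) := by positivity
  have hRN0 : 0 ≤ aK a₀ (L : ℝ) kk * (Fintype.card ι * (Fintype.card ι * ((1 + rV * ((((L ^ kk : ℕ) : ℝ))⁻¹)) ^ ((d + 1) * L ^ kk) - 1) ^ 2 + 2 * ((1 + rV * ((((L ^ kk : ℕ) : ℝ))⁻¹)) ^ ((d + 1) * L ^ kk) - 1))) := by positivity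
  have hRle' : rV * (1 + Fintype.card (Fin (d + 1) ⊕ Fin (d + 1))) + aK a₀ (L : ℝ) kk * (Fintype.card ι * (Fintype.card ι * ((1 + rV * ((((L ^ kk : ℕ) : ℝ))⁻¹)) ^ ((d + 1) * L ^ kk) - 1) ^ 2 + 2 * ((1 + rV * ((((L ^ kk : ℕ) : ℝ))⁻¹)) ^ ((d + 1) * L ^ kk) - 1))) ≤ R₀ :=
    by have := mul_le_mul_of_nonneg_right haKle hLσ0; linarith
  have habs : |(aK a₀ (L : ℝ) kk * (((L ^ kk : ℕ) : ℝ)) ^ (d + 1))| * ((((L ^ kk : ℕ) : ℝ)) ^ (d + 1))⁻¹ = aK a₀ (L : ℝ) kk := by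
    rw [abs_of_pos ha', mul_assoc, mul_inv_cancel₀ (by positivity), mul_one]
  -- the per-cube gauges and their (3.35) letters from the class on the boxes (dag-n15-w2)
  choose w hwu hwC hwA using fun k => uN_exists_gauge_cutCoefLetters_of_reg335Cube e (scShift d L mv kk hL) U he hη hU hξ hC (h335 k)
    (fun x hx => scChi_ne_zero_nbhd hL hL7 mv kk k x hx) hrA hrC
  refine ⟨w, fun k x => hwu k x, ?_⟩
  exact H mv kk hk hw₀' e he w (fun k x => hwu k x) (fun μ x => (U μ x : Matrix mm mm ℂ)) (scP d L mv kk hL (aK a₀ (L : ℝ) kk * (((L ^ kk : ℕ) : ℝ)) ^ (d + 1)) ι e (fun μ x => (U μ x : Matrix mm mm ℂ))) (scNV d L mv kk hL (aK a₀ (L : ℝ) kk * (((L ^ kk : ℕ) : ℝ)) ^ (d + 1)) ι e w (fun μ x => (U μ x : Matrix mm mm ℂ))) rV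
    (aK a₀ (L : ℝ) kk * (Fintype.card ι * (Fintype.card ι * ((1 + rV * ((((L ^ kk : ℕ) : ℝ))⁻¹)) ^ ((d + 1) * L ^ kk) - 1) ^ 2 + 2 * ((1 + rV * ((((L ^ kk : ℕ) : ℝ))⁻¹)) ^ ((d + 1) * L ^ kk) - 1)))) 0 hrV hRN0 le_rfl hRle' hθ₀.le
    (fun k => scP_conj ι e (aK a₀ (L : ℝ) kk * (((L ^ kk : ℕ) : ℝ)) ^ (d + 1)) w (fun μ x => (U μ x : Matrix mm mm ℂ)) k) (fun k => hwC k) (fun k => hwA k)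
    (fun k => (hasMaj_scNV_cut_of_rows ι e he (aK a₀ (L : ℝ) kk * (((L ^ kk : ℕ) : ℝ)) ^ (d + 1)) (fun k x => hwu k x) (fun μ x => (U μ x : Matrix mm mm ℂ)) hrV k (fun μ x hx i => hwA k (Sum.inl μ) x hx i) δ).mono fun y y' =>
      mul_le_mul_of_nonneg_right (le_of_eq (by rw [habs])) (Real.exp_nonneg _))
    (fun k => by
      rw [one_sub_scPsi_comp_scNV_comp_scChi ι e he hM hm₁ hfitI hS0 (aK a₀ (L : ℝ) kk * (((L ^ kk : ℕ) : ℝ)) ^ (d + 1)) (fun k x => hwu k x) (fun μ x => (U μ x : Matrix mm mm ℂ)) k]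
      exact (hasMaj_zero _ _).mono fun y y' => by positivity)

end Green

end Summit.QuantumFields.YangMills.BalabanUVNodes.N15.Gluing

end
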